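import Mathlib
import HarnessLib
import Literature.Analysis.OperatorTheory.L2KernelIntegralOperator
import Summits.HubbardSuperconductivity.HubbardSuperconductivity.Theorems.ChiralWindowCwKLChiralWindowFiniteMeasure
import Summits.HubbardSuperconductivity.HubbardSuperconductivity.Theorems.ChiralWindowCwKLChiralWindowGradient
import Summits.HubbardSuperconductivity.HubbardSuperconductivity.Theorems.ChiralWindowCwKLChiralWindowHausdorffFinite

/-!
# Route `ChiralWindow`, crux `CwKLChiralWindow` (item `stmt-HubbardSuperconductivity-1741`), line `Sketch`:
stub `stub_klKernelOp` — integral operators of square-integrable kernels on `L²(σ_μ)`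

For `μ ∈ (-4, 0)` the density-of-states measure `σ_μ = fermiCurveMeasure ε₀ μ` of the square-lattice band
`ε₀ = squareDispersion 1 0` is FINITE (`stub_klFiniteMeasure` from `stub_klGradient`, `stub_klHausdorffFinite`),
hence s-finite, and the generic Reed–Simon I, Thm. VI.23 package for an `L²(σ_μ ⊗ σ_μ)` kernel
(`Literature.Analysis.OperatorTheory.exists_l2KernelOp_package`: existence of the bounded integral operator
with the a.e. kernel formula; compactness, self-adjointness for symmetric kernels, the Hilbert–Schmidt bound
over finite orthonormal families and the inner-product formula for every operator with that a.e.
characterisation) specialises to the registered statement. No definitions. [folklore]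
-/

noncomputable section

-- the tree's namespace `Summit.<Summit>.<Problem>.Theorems` repeats the summit name by design (D-0017)
set_option linter.dupNamespace false

namespace Summit.HubbardSuperconductivity.HubbardSuperconductivity.Theorems

open MeasureTheory Literature.MathematicalPhysics.QuantumLattice

/-- **Integral operators of square-integrable kernels on `L²(σ_μ)`** (`σ_μ = fermiCurveMeasure ε₀ μ`, finite for
`μ ∈ (-4,0)`): an `L²(σ⊗σ)` kernel `K` has a bounded integral operator `A` on `L²(σ)`
(`(Aφ)(k) = ∫ K(k,k') φ(k') dσ(k')` a.e.); any such `A` is compact, self-adjoint when `K` is symmetric, its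
Hilbert–Schmidt sums over finite orthonormal families are `≤ ‖K‖²_{L²(σ⊗σ)}`, and
`⟨ψ, Aφ⟩ = ∫ ψ (∫ K φ)` (Reed–Simon I, Thm. VI.23, through the generic
`Literature.Analysis.OperatorTheory.exists_l2KernelOp_package`). [cite: ReedSimonI1980, Thm. VI.23] -/
theorem stub_klKernelOp : ∀ μ ∈ Set.Ioo (-4 : ℝ) 0, ∀ K : Momentum → Momentum → ℝ,
    MemLp (Function.uncurry K) 2
      ((fermiCurveMeasure (squareDispersion 1 0) μ).prod (fermiCurveMeasure (squareDispersion 1 0) μ)) →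
    (∃ A : Lp ℝ 2 (fermiCurveMeasure (squareDispersion 1 0) μ) →L[ℝ] Lp ℝ 2 (fermiCurveMeasure (squareDispersion 1 0) μ),
      ∀ φ : Lp ℝ 2 (fermiCurveMeasure (squareDispersion 1 0) μ),
        (A φ : Momentum → ℝ) =ᵐ[fermiCurveMeasure (squareDispersion 1 0) μ]
          fun k => ∫ k', K k k' * φ k' ∂fermiCurveMeasure (squareDispersion 1 0) μ) ∧
    (∀ A : Lp ℝ 2 (fermiCurveMeasure (squareDispersion 1 0) μ) →L[ℝ] Lp ℝ 2 (fermiCurveMeasure (squareDispersion 1 0) μ),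
      (∀ φ : Lp ℝ 2 (fermiCurveMeasure (squareDispersion 1 0) μ),
        (A φ : Momentum → ℝ) =ᵐ[fermiCurveMeasure (squareDispersion 1 0) μ]
          fun k => ∫ k', K k k' * φ k' ∂fermiCurveMeasure (squareDispersion 1 0) μ) →
      IsCompactOperator A ∧
      ((∀ k k', K k k' = K k' k) → IsSelfAdjoint A) ∧
      (∀ (m : ℕ) (f : Fin m → Lp ℝ 2 (fermiCurveMeasure (squareDispersion 1 0) μ)), Orthonormal ℝ f →
        ∑ i, ‖A (f i)‖ ^ 2 ≤
          ∫ z, K z.1 z.2 ^ 2 ∂(fermiCurveMeasure (squareDispersion 1 0) μ).prod (fermiCurveMeasure (squareDispersion 1 0) μ)) ∧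
      (∀ φ ψ : Lp ℝ 2 (fermiCurveMeasure (squareDispersion 1 0) μ),
        inner ℝ ψ (A φ) =
          ∫ k, ψ k * ∫ k', K k k' * φ k' ∂fermiCurveMeasure (squareDispersion 1 0) μ
            ∂fermiCurveMeasure (squareDispersion 1 0) μ)) := by
  intro μ hμ K hK
  haveI := stub_klFiniteMeasure stub_klGradient stub_klHausdorffFinite μ hμ
  exact Literature.Analysis.OperatorTheory.exists_l2KernelOp_package hK

end Summit.HubbardSuperconductivity.HubbardSuperconductivity.Theorems

end
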